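import Mathlib

/-!
# `XMapKernel` (stmt-KontsevichZagierPeriods-10663, route IsogenyCertificates) — line
`derived-datum-quasi-periods`, stub `stub_derivedDatum`

The **derived datum** of an x-rational isogeny datum. Let `(f, g, c)` be a COPRIME datum from
`P = X³ + AX + B` to `Q = X³ + A'X + B'` over `ℚ`, i.e. `W := f'g − fg' ≠ 0` and
`c²·g·(f³ + A'fg² + B'g³) = P·W²` in `ℚ[X]` (the ODE `c²·Q(R) = P·R'²` of the x-map `R = f/g`,
cleared of denominators). Then
`E := c²·f·g + 2·P·(g·g″ − g′²) + P′·g·g′ = (α + β·X)·g²` with `β ≠ 0`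
(`stub_derivedDatum`); equivalently `c²·R = α + βx + L(−2g′/g)` with `L(S) = P·S′ + ½·P′·S`,
which is Elkies' formula for the x-map read off the ODE alone (cf. Kohel 1996, §2.4, after Vélu).

Proof (pure polynomial algebra over `ℚ`, no passage to an algebraic closure):
* `g² ∣ E` (`sq_dvd_derived`): reducing the identity `D = 0` modulo `g²` and cancelling the unit
  `f` of `ℚ[X]/(g²)` gives `g² ∣ K := c²f²g + 2Pf′gg′ − Pfg′²`; differentiating `D = 0` and
  cancelling `W ≠ 0` gives the polynomial form `Z = 0` of `2P·R″ + P′·R′ = c²·Q′(R)`; and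
  `f·E = g²·(2Pf″ + P′f′ − c²A′g) − 2K − Z` is a ring identity, so `g² ∣ f·E`, hence `g² ∣ E`.
* `deg f ≤ deg g + 1` (`natDegree_le_of_datum`, comparing top coefficients of the identity), so
  `deg E ≤ 2·deg g + 1` and the cofactor is linear (`linear_of_sq_dvd`).
* `β ≠ 0`: the `X^{2n+1}`-coefficient of `E` (`n = deg g`) is `g_n·(c²·f_{n+1} + n·g_n)`
  (`derived_top_succ`; for `n = 0` it is `c²·f₁·g₀`), and when `deg f = n + 1` the top
  coefficients of the identity give `c²·f_{n+1} = g_n` (`derived_lead`), so it equals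
  `max(deg f, deg g)·g_n² ≠ 0`.
Calibrations: `(X² − 1, X, 1)` on `y² = x³ − x`: `E = 2X·g²`; `(X³ + 4, X², 1)`: `E = 3X·g²`.
-/

open Polynomial

namespace Summit.KontsevichZagierPeriods.IsogenyCertificates.XMapKernelStubs.DerivedDatum

/-- **Divisibility `g² ∣ E`.** For coprime `f, g` with `W = f′g − fg′ ≠ 0` and
`c²·g·(f³ + A′fg² + B′g³) = P·W²` (any `P`), `g²` divides
`c²fg + 2P(gg″ − g′²) + P′gg′`. [folklore] -/
theorem sq_dvd_derived {f g P : ℚ[X]} {c A' B' : ℚ} (hcop : IsCoprime f g)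
    (hW : derivative f * g - f * derivative g ≠ 0)
    (hD : C (c ^ 2) * g * (f ^ 3 + C A' * f * g ^ 2 + C B' * g ^ 3) =
      P * (derivative f * g - f * derivative g) ^ 2) :
    g ^ 2 ∣ C (c ^ 2) * f * g + C 2 * P * (g * derivative (derivative g) - derivative g ^ 2) +
      derivative P * g * derivative g := by
  -- (1) `g² ∣ K`: the identity modulo `g²` is `f·K ≡ 0`, and `f` is a unit modulo `g²`
  have hK : g ^ 2 ∣ C (c ^ 2) * f ^ 2 * g + 2 * P * derivative f * g * derivative g
      - P * f * derivative g ^ 2 := by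
    refine (hcop.symm.pow_left (m := 2)).dvd_of_dvd_mul_left
      ⟨-(C (c ^ 2) * C A' * f * g + C (c ^ 2) * C B' * g ^ 2 - P * derivative f ^ 2), ?_⟩
    linear_combination hD
  -- (2) the derivative of the identity
  have hD' := congrArg derivative hD
  simp only [derivative_mul, derivative_add, derivative_pow, derivative_C, zero_mul, zero_add,
    derivative_sub, Nat.cast_ofNat, C_ofNat, Nat.reduceSub, pow_one] at hD'
  -- (3) `Z = 0`, i.e. `2P W′ g − 4P W g′ + P′ W g = c² g (3f² + A′g²)` (cancel `W ≠ 0`)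
  have hZ : 2 * P * (derivative (derivative f) * g - f * derivative (derivative g)) * g
      - 4 * P * (derivative f * g - f * derivative g) * derivative g
      + derivative P * (derivative f * g - f * derivative g) * g
      - C (c ^ 2) * g * (3 * f ^ 2 + C A' * g ^ 2) = 0 := by
    have h : (derivative f * g - f * derivative g) *
        (2 * P * (derivative (derivative f) * g - f * derivative (derivative g)) * g
        - 4 * P * (derivative f * g - f * derivative g) * derivative g
        + derivative P * (derivative f * g - f * derivative g) * g
        - C (c ^ 2) * g * (3 * f ^ 2 + C A' * g ^ 2)) = 0 := by
      linear_combination (-g) * hD' + (4 * derivative g) * hD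
    exact (mul_eq_zero.1 h).resolve_left hW
  -- (4) `f·E = g²·T − 2K`, so `g² ∣ f·E`, so `g² ∣ E`
  have h2 : (C 2 : ℚ[X]) = 2 := rfl
  rw [h2]
  have hfE : f * (C (c ^ 2) * f * g + 2 * P * (g * derivative (derivative g) - derivative g ^ 2)
      + derivative P * g * derivative g)
      = g ^ 2 * (2 * P * derivative (derivative f) + derivative P * derivative f
          - C (c ^ 2) * C A' * g)
        - 2 * (C (c ^ 2) * f ^ 2 * g + 2 * P * derivative f * g * derivative g
          - P * f * derivative g ^ 2) := by
    linear_combination (-1 : ℚ[X]) * hZ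
  refine (hcop.symm.pow_left (m := 2)).dvd_of_dvd_mul_left ?_
  rw [hfE]
  exact dvd_sub (dvd_mul_right _ _) (hK.mul_left 2)

/-- A polynomial divisible by `g²` (`g ≠ 0`, `n = deg g`), of degree `≤ 2n + 1` and with nonzero
`X^{2n+1}`-coefficient, is `(α + βX)·g²` with `β ≠ 0`. [folklore] -/
theorem linear_of_sq_dvd {g E : ℚ[X]} (hg : g ≠ 0) (hdvd : g ^ 2 ∣ E)
    (hdeg : E.natDegree ≤ 2 * g.natDegree + 1) (hcoeff : E.coeff (2 * g.natDegree + 1) ≠ 0) :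
    ∃ α β : ℚ, β ≠ 0 ∧ E = (C α + C β * X) * g ^ 2 := by
  obtain ⟨q, rfl⟩ := hdvd
  have hq0 : q ≠ 0 := by
    rintro rfl
    simp at hcoeff
  have hdq : q.natDegree ≤ 1 := by
    have h := natDegree_mul (pow_ne_zero 2 hg) hq0
    rw [natDegree_pow] at h
    omega
  obtain ⟨β, α, hq⟩ := exists_eq_X_add_C_of_natDegree_le_one hdq
  subst hq
  refine ⟨α, β, ?_, by ring⟩
  rintro rfl
  apply hcoeff
  rw [coeff_mul_add_eq_of_natDegree_le (natDegree_pow_le_of_le 2 le_rfl) natDegree_linear_le]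
  simp

/-- `deg (f′g − fg′) ≤ deg f + deg g − 1` (a constant factor has zero derivative). [folklore] -/
theorem natDegree_wronskian_le (f g : ℚ[X]) :
    (derivative f * g - f * derivative g).natDegree ≤ f.natDegree + g.natDegree - 1 := by
  refine (natDegree_sub_le _ _).trans (max_le ?_ ?_)
  · by_cases hf : f.natDegree = 0
    · rw [derivative_of_natDegree_zero hf, zero_mul, natDegree_zero]
      exact Nat.zero_le _
    · have := natDegree_derivative_le f
      exact natDegree_mul_le.trans (by omega)
  · by_cases hg0 : g.natDegree = 0
    · rw [derivative_of_natDegree_zero hg0, mul_zero, natDegree_zero]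
      exact Nat.zero_le _
    · have := natDegree_derivative_le g
      exact natDegree_mul_le.trans (by omega)

/-- **Degree bound** `deg f ≤ deg g + 1` for a datum with `c ≠ 0`, `g ≠ 0` and `deg P ≤ 3`:
otherwise the `X^{deg g + 3 deg f}`-coefficient of the identity reads `c²·g_top·f_top³ = 0`.
[folklore] -/
theorem natDegree_le_of_datum {f g P : ℚ[X]} {c A' B' : ℚ} (hc : c ≠ 0) (hg : g ≠ 0)
    (hD : C (c ^ 2) * g * (f ^ 3 + C A' * f * g ^ 2 + C B' * g ^ 3) =
      P * (derivative f * g - f * derivative g) ^ 2)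
    (hP3 : P.natDegree ≤ 3) : f.natDegree ≤ g.natDegree + 1 := by
  by_contra h
  push Not at h
  have hf0 : f ≠ 0 := by
    rintro rfl
    simp at h
  have hWd := natDegree_wronskian_le f g
  have hR : (P * (derivative f * g - f * derivative g) ^ 2).natDegree <
      g.natDegree + 3 * f.natDegree :=
    (natDegree_mul_le.trans (add_le_add hP3 (natDegree_pow_le_of_le 2 hWd))).trans_lt (by omega)
  have h0 := coeff_eq_zero_of_natDegree_lt hR
  rw [← hD] at h0
  have h1 : (C (c ^ 2) * g).natDegree ≤ g.natDegree := natDegree_C_mul_le _ _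
  have hQ : (f ^ 3 + C A' * f * g ^ 2 + C B' * g ^ 3).natDegree ≤ 3 * f.natDegree := by
    refine natDegree_add_le_of_degree_le (natDegree_add_le_of_degree_le
      (natDegree_pow_le_of_le 3 le_rfl) (natDegree_mul_le.trans ?_))
      ((natDegree_C_mul_le _ _).trans ((natDegree_pow_le_of_le 3 le_rfl).trans (by omega)))
    have := add_le_add (natDegree_C_mul_le A' f) (natDegree_pow_le_of_le 2 (le_refl g.natDegree))
    omega
  have e1 : (f ^ 3).coeff (3 * f.natDegree) = f.coeff f.natDegree ^ 3 :=
    coeff_pow_of_natDegree_le le_rfl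
  have e2 : (C A' * f * g ^ 2).coeff (3 * f.natDegree) = 0 := by
    refine coeff_eq_zero_of_natDegree_lt (natDegree_mul_le.trans_lt ?_)
    have := add_le_add (natDegree_C_mul_le A' f) (natDegree_pow_le_of_le 2 (le_refl g.natDegree))
    omega
  have e3 : (C B' * g ^ 3).coeff (3 * f.natDegree) = 0 := by
    refine coeff_eq_zero_of_natDegree_lt ((natDegree_C_mul_le _ _).trans_lt ?_)
    exact (natDegree_pow_le_of_le 3 le_rfl).trans_lt (by omega)
  rw [coeff_mul_add_eq_of_natDegree_le h1 hQ, coeff_C_mul, coeff_add, coeff_add, e1, e2, e3,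
    add_zero, add_zero] at h0
  exact (mul_ne_zero (mul_ne_zero (pow_ne_zero 2 hc) (leadingCoeff_ne_zero.2 hg))
    (pow_ne_zero 3 (leadingCoeff_ne_zero.2 hf0))) h0

/-- **Top coefficients of the identity** when `deg f ≤ m + 2`, `deg g ≤ m + 1`, `deg P ≤ 3`,
`P₃ = 1`: the `X^{4m+7}`-coefficients give `c²·g_{m+1}·f_{m+2}³ = (f_{m+2}·g_{m+1})²`
(the `X^{2m+2}`-coefficient of `W` is `(m+2)f_{m+2}g_{m+1} − (m+1)f_{m+2}g_{m+1}`). [folklore] -/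
theorem derived_lead {f g P : ℚ[X]} {c A' B' : ℚ} {m : ℕ}
    (hD : C (c ^ 2) * g * (f ^ 3 + C A' * f * g ^ 2 + C B' * g ^ 3) =
      P * (derivative f * g - f * derivative g) ^ 2)
    (hf : f.natDegree ≤ m + 2) (hg : g.natDegree ≤ m + 1) (hP3 : P.natDegree ≤ 3)
    (hPc : P.coeff 3 = 1) :
    c ^ 2 * g.coeff (m + 1) * f.coeff (m + 2) ^ 3 = (f.coeff (m + 2) * g.coeff (m + 1)) ^ 2 := by
  have hf' : (derivative f).natDegree ≤ m + 1 := (natDegree_derivative_le f).trans (by omega)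
  have hg' : (derivative g).natDegree ≤ m := (natDegree_derivative_le g).trans (by omega)
  have hW : (derivative f * g - f * derivative g).natDegree ≤ 2 * m + 2 :=
    (natDegree_sub_le _ _).trans (max_le (natDegree_mul_le.trans (by omega))
      (natDegree_mul_le.trans (by omega)))
  have hWc : (derivative f * g - f * derivative g).coeff (2 * m + 2) =
      f.coeff (m + 2) * g.coeff (m + 1) := by
    rw [coeff_sub, show 2 * m + 2 = (m + 1) + (m + 1) by ring,
      coeff_mul_add_eq_of_natDegree_le hf' hg, show (m + 1) + (m + 1) = (m + 2) + m by ring,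
      coeff_mul_add_eq_of_natDegree_le hf hg', coeff_derivative, coeff_derivative]
    push_cast
    ring
  have hR : (P * (derivative f * g - f * derivative g) ^ 2).coeff (4 * m + 7) =
      (f.coeff (m + 2) * g.coeff (m + 1)) ^ 2 := by
    rw [show 4 * m + 7 = 3 + 2 * (2 * m + 2) by ring,
      coeff_mul_add_eq_of_natDegree_le hP3 (natDegree_pow_le_of_le 2 hW), hPc,
      coeff_pow_of_natDegree_le hW, hWc, one_mul]
  have h1 : (C (c ^ 2) * g).natDegree ≤ m + 1 := (natDegree_C_mul_le _ _).trans hg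
  have hQ : (f ^ 3 + C A' * f * g ^ 2 + C B' * g ^ 3).natDegree ≤ 3 * (m + 2) := by
    refine natDegree_add_le_of_degree_le (natDegree_add_le_of_degree_le
      (natDegree_pow_le_of_le 3 hf) (natDegree_mul_le.trans ?_))
      ((natDegree_C_mul_le _ _).trans ((natDegree_pow_le_of_le 3 hg).trans (by omega)))
    have := add_le_add ((natDegree_C_mul_le A' f).trans hf) (natDegree_pow_le_of_le 2 hg)
    omega
  have e1 : (f ^ 3).coeff (3 * (m + 2)) = f.coeff (m + 2) ^ 3 := coeff_pow_of_natDegree_le hf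
  have e2 : (C A' * f * g ^ 2).coeff (3 * (m + 2)) = 0 := by
    refine coeff_eq_zero_of_natDegree_lt (natDegree_mul_le.trans_lt ?_)
    have := add_le_add ((natDegree_C_mul_le A' f).trans hf) (natDegree_pow_le_of_le 2 hg)
    omega
  have e3 : (C B' * g ^ 3).coeff (3 * (m + 2)) = 0 :=
    coeff_eq_zero_of_natDegree_lt ((natDegree_C_mul_le _ _).trans_lt
      ((natDegree_pow_le_of_le 3 hg).trans_lt (by omega)))
  have hL : (C (c ^ 2) * g * (f ^ 3 + C A' * f * g ^ 2 + C B' * g ^ 3)).coeff (4 * m + 7) =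
      c ^ 2 * g.coeff (m + 1) * f.coeff (m + 2) ^ 3 := by
    rw [show 4 * m + 7 = (m + 1) + 3 * (m + 2) by ring, coeff_mul_add_eq_of_natDegree_le h1 hQ,
      coeff_C_mul, coeff_add, coeff_add, e1, e2, e3]
    ring
  rw [← hL, ← hR, hD]

/-- **Top coefficient of `E`** when `deg g = m + 1`, `deg f ≤ m + 2`, `deg P ≤ 3`, `P₃ = 1`:
`deg E ≤ 2m + 3` and `E_{2m+3} = g_{m+1}·(c²·f_{m+2} + (m+1)·g_{m+1})` (the contributions of
`2P(gg″ − g′²)` and `P′gg′` are `−2(m+1)g_{m+1}²` and `3(m+1)g_{m+1}²`). [folklore] -/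
theorem derived_top_succ {f g P : ℚ[X]} {c : ℚ} {m : ℕ} (hn : g.natDegree = m + 1)
    (hf : f.natDegree ≤ m + 2) (hP3 : P.natDegree ≤ 3) (hPc : P.coeff 3 = 1) :
    (C (c ^ 2) * f * g + C 2 * P * (g * derivative (derivative g) - derivative g ^ 2) +
        derivative P * g * derivative g).natDegree ≤ 2 * m + 3 ∧
      (C (c ^ 2) * f * g + C 2 * P * (g * derivative (derivative g) - derivative g ^ 2) +
        derivative P * g * derivative g).coeff (2 * m + 3) =
      g.coeff (m + 1) * (c ^ 2 * f.coeff (m + 2) + (m + 1) * g.coeff (m + 1)) := by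
  have hg1 : g.natDegree ≤ m + 1 := hn.le
  have hd1 : (derivative g).natDegree ≤ m := (natDegree_derivative_le g).trans (by omega)
  have hd1c : (derivative g).coeff m = (m + 1) * g.coeff (m + 1) := by
    rw [coeff_derivative]
    ring
  -- `N = g g′`
  have hN : (g * derivative g).natDegree ≤ 2 * m + 1 := natDegree_mul_le.trans (by omega)
  have hNc : (g * derivative g).coeff (2 * m + 1) = (m + 1) * g.coeff (m + 1) ^ 2 := by
    rw [show 2 * m + 1 = (m + 1) + m by ring, coeff_mul_add_eq_of_natDegree_le hg1 hd1, hd1c]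
    ring
  have hN' : (derivative (g * derivative g)).natDegree ≤ 2 * m :=
    (natDegree_derivative_le _).trans (by omega)
  have hN'c : (derivative (g * derivative g)).coeff (2 * m) =
      (2 * m + 1) * ((m + 1) * g.coeff (m + 1) ^ 2) := by
    rw [coeff_derivative, hNc]
    push_cast
    ring
  -- `M = g g″ − g′² = N′ − 2 g′²`
  have hMeq : g * derivative (derivative g) - derivative g ^ 2 =
      derivative (g * derivative g) - C 2 * derivative g ^ 2 := by
    rw [derivative_mul, show (C 2 : ℚ[X]) = 2 from rfl]
    ring
  have hS : (derivative g ^ 2).natDegree ≤ 2 * m := natDegree_pow_le_of_le 2 hd1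
  have hM : (g * derivative (derivative g) - derivative g ^ 2).natDegree ≤ 2 * m := by
    rw [hMeq]
    exact (natDegree_sub_le _ _).trans (max_le hN' ((natDegree_C_mul_le _ _).trans hS))
  have hMc : (g * derivative (derivative g) - derivative g ^ 2).coeff (2 * m) =
      -(m + 1) * g.coeff (m + 1) ^ 2 := by
    rw [hMeq, coeff_sub, coeff_C_mul, hN'c, coeff_pow_of_natDegree_le hd1, hd1c]
    ring
  -- `P′`
  have hP' : (derivative P).natDegree ≤ 2 := (natDegree_derivative_le P).trans (by omega)
  have hP'c : (derivative P).coeff 2 = 3 := by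
    rw [coeff_derivative, hPc]
    norm_num
  -- the three terms
  have h1 : (C (c ^ 2) * f * g).natDegree ≤ 2 * m + 3 := by
    rw [mul_assoc]
    exact (natDegree_C_mul_le _ _).trans (natDegree_mul_le.trans (by omega))
  have h2 : (C 2 * P * (g * derivative (derivative g) - derivative g ^ 2)).natDegree ≤
      2 * m + 3 := by
    rw [mul_assoc]
    refine (natDegree_C_mul_le _ _).trans (natDegree_mul_le.trans ?_)
    have := add_le_add hP3 hM
    omega
  have h3 : (derivative P * g * derivative g).natDegree ≤ 2 * m + 3 := by
    rw [mul_assoc]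
    refine natDegree_mul_le.trans ?_
    have := add_le_add hP' hN
    omega
  have e1 : (C (c ^ 2) * f * g).coeff (2 * m + 3) = c ^ 2 * (f.coeff (m + 2) * g.coeff (m + 1)) := by
    rw [mul_assoc, coeff_C_mul, show 2 * m + 3 = (m + 2) + (m + 1) by ring,
      coeff_mul_add_eq_of_natDegree_le hf hg1]
  have e2 : (C 2 * P * (g * derivative (derivative g) - derivative g ^ 2)).coeff (2 * m + 3) =
      2 * (-(m + 1) * g.coeff (m + 1) ^ 2) := by
    rw [mul_assoc, coeff_C_mul, show 2 * m + 3 = 3 + 2 * m by ring,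
      coeff_mul_add_eq_of_natDegree_le hP3 hM, hPc, hMc, one_mul]
  have e3 : (derivative P * g * derivative g).coeff (2 * m + 3) =
      3 * ((m + 1) * g.coeff (m + 1) ^ 2) := by
    rw [mul_assoc, show 2 * m + 3 = 2 + (2 * m + 1) by ring,
      coeff_mul_add_eq_of_natDegree_le hP' hN, hP'c, hNc]
  refine ⟨natDegree_add_le_of_degree_le (natDegree_add_le_of_degree_le h1 h2) h3, ?_⟩
  rw [coeff_add, coeff_add, e1, e2, e3]
  ring

/-- **The derived datum, general form.** For a coprime datum `(f, g, c)` over any `P` with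
`deg P ≤ 3`, `P₃ = 1`: `c²fg + 2P(gg″ − g′²) + P′gg′ = (α + βX)·g²` with `β ≠ 0`
(`β = max (deg f) (deg g)`). [folklore] -/
theorem derived_of_datum {f g P : ℚ[X]} {c A' B' : ℚ} (hcop : IsCoprime f g)
    (hW : derivative f * g - f * derivative g ≠ 0)
    (hD : C (c ^ 2) * g * (f ^ 3 + C A' * f * g ^ 2 + C B' * g ^ 3) =
      P * (derivative f * g - f * derivative g) ^ 2)
    (hP3 : P.natDegree ≤ 3) (hPc : P.coeff 3 = 1) :
    ∃ α β : ℚ, β ≠ 0 ∧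
      C (c ^ 2) * f * g + C 2 * P * (g * derivative (derivative g) - derivative g ^ 2) +
        derivative P * g * derivative g = (C α + C β * X) * g ^ 2 := by
  have hP0 : P ≠ 0 := by
    rintro rfl
    simp at hPc
  have hg : g ≠ 0 := by
    rintro rfl
    exact hW (by simp)
  have hc : c ≠ 0 := by
    rintro rfl
    refine mul_ne_zero hP0 (pow_ne_zero 2 hW) ?_
    rw [← hD]
    simp
  have hfdeg := natDegree_le_of_datum hc hg hD hP3
  refine linear_of_sq_dvd hg (sq_dvd_derived hcop hW hD) ?_ ?_
  · -- degree bound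
    rcases Nat.eq_zero_or_pos g.natDegree with hn | hn
    · have hd0 : derivative g = 0 := derivative_of_natDegree_zero hn
      rw [hd0, derivative_zero, mul_zero, mul_zero, zero_pow two_ne_zero, sub_zero, mul_zero,
        add_zero, add_zero, hn, mul_assoc]
      refine (natDegree_C_mul_le _ _).trans (natDegree_mul_le.trans ?_)
      omega
    · obtain ⟨m, hm⟩ : ∃ m, g.natDegree = m + 1 := ⟨g.natDegree - 1, by omega⟩
      rw [hm, show 2 * (m + 1) + 1 = 2 * m + 3 by ring]
      exact (derived_top_succ (c := c) hm (by omega) hP3 hPc).1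
  · -- top coefficient
    rcases Nat.eq_zero_or_pos g.natDegree with hn | hn
    · have hd0 : derivative g = 0 := derivative_of_natDegree_zero hn
      have hf1 : f.natDegree = 1 := by
        have hfn : f.natDegree ≠ 0 := fun h0 =>
          hW (by rw [derivative_of_natDegree_zero h0, hd0, zero_mul, mul_zero, sub_zero])
        omega
      have hfc : f.coeff 1 ≠ 0 := by
        have := leadingCoeff_ne_zero.2 (ne_zero_of_natDegree_gt (n := 0) (by omega) : f ≠ 0)
        rwa [leadingCoeff, hf1] at this
      have hgc : g.coeff 0 ≠ 0 := by
        have := leadingCoeff_ne_zero.2 hg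
        rwa [leadingCoeff, hn] at this
      rw [hd0, derivative_zero, mul_zero, mul_zero, zero_pow two_ne_zero, sub_zero, mul_zero,
        add_zero, add_zero, hn, mul_assoc, coeff_C_mul, show 2 * 0 + 1 = 1 + 0 by ring,
        coeff_mul_add_eq_of_natDegree_le hf1.le hn.le]
      exact mul_ne_zero (pow_ne_zero 2 hc) (mul_ne_zero hfc hgc)
    · obtain ⟨m, hm⟩ : ∃ m, g.natDegree = m + 1 := ⟨g.natDegree - 1, by omega⟩
      rw [hm, show 2 * (m + 1) + 1 = 2 * m + 3 by ring,
        (derived_top_succ (c := c) hm (by omega) hP3 hPc).2]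
      have hgc : g.coeff (m + 1) ≠ 0 := by
        have := leadingCoeff_ne_zero.2 hg
        rwa [leadingCoeff, hm] at this
      by_cases hfe : f.natDegree ≤ m + 1
      · rw [coeff_eq_zero_of_natDegree_lt (by omega : f.natDegree < m + 2), mul_zero, zero_add]
        exact mul_ne_zero hgc (mul_ne_zero (by positivity) hgc)
      · have hfe' : f.natDegree = m + 2 := by omega
        have hfc : f.coeff (m + 2) ≠ 0 := by
          have := leadingCoeff_ne_zero.2 (ne_zero_of_natDegree_gt (n := 0) (by omega) : f ≠ 0)
          rwa [leadingCoeff, hfe'] at this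
        have hlead := derived_lead hD hfe'.le hm.le hP3 hPc
        have hcf : c ^ 2 * f.coeff (m + 2) = g.coeff (m + 1) := by
          have h0 : f.coeff (m + 2) ^ 2 * g.coeff (m + 1) *
              (c ^ 2 * f.coeff (m + 2) - g.coeff (m + 1)) = 0 := by
            linear_combination hlead
          simpa [sub_eq_zero, hfc, hgc] using h0
        rw [hcf, show g.coeff (m + 1) + (m + 1) * g.coeff (m + 1) = (m + 2) * g.coeff (m + 1) by
          ring]
        exact mul_ne_zero hgc (mul_ne_zero (by positivity) hgc)

/-- **DD — the derived datum** (registered stub `stub_derivedDatum` of the line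
`derived-datum-quasi-periods`): for a COPRIME x-rational isogeny datum `(f, g, c)` from the
nonsingular `P = X³ + AX + B` to `Q = X³ + A′X + B′` (`W = f′g − fg′ ≠ 0`,
`c²·g·(f³ + A′fg² + B′g³) = P·W²`) one has
`c²·f·g + 2·P·(g·g″ − g′²) + P′·g·g′ = (α + β·X)·g²` with `α, β ∈ ℚ`, `β ≠ 0`; equivalently
`c²·(f/g) = α + βx + L(−2g′/g)`, `L(S) = P·S′ + ½·P′·S` — Elkies' formula for the x-map of an
isogeny recovered from the ODE `c²·Q(R) = P·R′²` alone (cf. Kohel 1996, §2.4). The discriminant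
hypotheses are not used. [folklore] -/
theorem stub_derivedDatum : ∀ (A B A' B' : ℤ) (f g : ℚ[X]) (c : ℚ),
    4 * A ^ 3 + 27 * B ^ 2 ≠ 0 → 4 * A' ^ 3 + 27 * B' ^ 2 ≠ 0 → IsCoprime f g →
    derivative f * g - f * derivative g ≠ 0 →
    C (c ^ 2) * g * (f ^ 3 + C (A' : ℚ) * f * g ^ 2 + C (B' : ℚ) * g ^ 3) =
      (X ^ 3 + C (A : ℚ) * X + C (B : ℚ)) * (derivative f * g - f * derivative g) ^ 2 →
    ∃ α β : ℚ, β ≠ 0 ∧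
      C (c ^ 2) * f * g + C 2 * (X ^ 3 + C (A : ℚ) * X + C (B : ℚ)) *
          (g * derivative (derivative g) - derivative g ^ 2) +
        derivative (X ^ 3 + C (A : ℚ) * X + C (B : ℚ)) * g * derivative g =
      (C α + C β * X) * g ^ 2 := by
  intro A B A' B' f g c _ _ hcop hW hD
  exact derived_of_datum hcop hW hD (by compute_degree)
    (by simp only [coeff_add, coeff_C_mul, coeff_X_pow, coeff_X, coeff_C]; norm_num)

end Summit.KontsevichZagierPeriods.IsogenyCertificates.XMapKernelStubs.DerivedDatum
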